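/-
Copyright (c) 2026 the pub-hodgecm-mathlib formalisation cell (harness21).  Prover seat hodgecm-mathlib-A-p19 (g19), topic T5 = P8
«(C♯)hol interior», row «T5-B(3b) COINVARIANT JUNCTION» (desk F0P2-plan (g8), PLAN-P2 v8 §4 #3 = `F0/P2/T5b-TREE.md` §8.2), 2026-08-31.
KERNEL module: THEOREMS ONLY (no definition, no named fact, no `sorry`, no instance, no notation).  File 1∕2 of the row.
-/
import Literature.NumberTheory.Automorphic.Liu2021.ThetaLiftFromLinePureTensor
import Literature.NumberTheory.Automorphic.Liu2021.Def411WeilCarriersAtLine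
import Literature.NumberTheory.GelbartRogawski1991.UnitaryDualPairThetaKernelCMKTypeFin
import Literature.NumberTheory.Automorphic.UnitaryGroupLevelTransport
import HarnessLib

/-!
# Node B of the T5 line, step (3b), file 1∕2: THE COINVARIANT RELATIONS — the class `[Θ̃_{R_e E(Φ_∞ ⊗ Φ_f)}(f) ∘ ιA] ∈ L²([U(H)])`
# as a function of the finite Schwartz–Bruhat factor `Φ_f` (linear, `χ_W`-covariant, `U(H)(𝔸_{L⁺,f})`-equivariant)

Topic `NumberTheory/Automorphic/Liu2021`; namespace `Literature.NumberTheory.Automorphic.Liu2021`.  KERNEL: theorems only.  Cell hodgecm-mathlib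
FLOOR 0, programme P2, topic T5 = P8 «(C♯)hol interior» (`F0/P2/T5b-TREE.md` §8.2, node B «finite local–global», step (3b) — the ONE remaining
hand for `stub B` after ★ (1b) `ThetaLiftFromLinePureTensor`; sequel = `ThetaLiftFromLineFinIntertwiner` (the intertwiner and `HasFinComponent`)).

[Liu2021, proof of Prop. 4.13, Case 1, l. 2136–2137] «In other words … `π^∞ ≃ ω(μ, ε_e, χ)`»: once the discrete `P` contains the projection of a
global theta lift `Θ_{Φ_∞ ⊗ Φ_f}(χ̃)` from the line `⟨a⟩` (★ `MeetsThetaLiftFromLine`, read at a genuine `χ ∈ Chi` and a pure tensor by ★ (5) + ★ (1b)),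
FIX `Φ_∞` and vary `Φ_f` in the Kronecker currency `𝒮((𝔸_{L⁺}^∞)^{N×1}) = FinSB L⁺ (Fin N × Fin 1)` of the finite Weil representation ★ `WeilCoinv.finPairRep`
(the adelic datum is `R_{e₁} E(Φ_∞ ⊗ Φ_f)`, ★ `piSBReindex` ∘ ★ `piSchwartzBruhatEquiv`).  This file proves the three relations the coinvariant junction needs:

* §0 `coe_finPart_cmAdelicFrameTransport_finAdelicToAdelic`, `eq_finPart_cmAdelicFrameTransport_finAdelicToAdelic_of_coe`,
  `cmAdelicFrameTransport_finAdelicToAdelic` — the finite frame transport `ιV` of the letter (C♯)hol ∕ node B, pinned only by its matrix formula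
  `↑(ιV k) = g_f⁻¹ k g_f`, IS the canonical `k ↦ (g_𝔸⁻¹ (1,k) g_𝔸)_f = finPart ∘ cmAdelicFrameTransport ∘ finAdelicToAdelic` (★
  `UnitaryDualPairThetaKernelCMKTypeFin`), and `ιA (1,k) = (1, ιV k)`; `DiscreteAutomorphicRep.finRep_apply` (unfolding ★ `finRep`).
* §1 (generic rank `N`, any weight `f`) the class `[Θ̃_{R_e E(Φ_∞ ⊗ Φ_f)}(f) ∘ ιA]`: ADDITIVE and HOMOGENEOUS in `Φ_f` (`toLp_lineThetaLift_tensor_add ∕ _smul`,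
  ★ B-p04 `toLp_lineThetaLift_add_left ∕ _smul_left`); `U(H)(𝔸_{L⁺,f})`-EQUIVARIANT — `R((1,k)) [Θ̃_{R_e E(Φ_∞ ⊗ Φ_f)}(f) ∘ ιA] =
  [Θ̃_{R_e E(Φ_∞ ⊗ ω_f(ιV k,1)Φ_f)}(f) ∘ ιA]` (`rightRegular_finAdelicToAdelic_toLp_lineThetaLift_tensor`: ★ `rightRegular_toLp_lineThetaLift` + §0 + the
  `arch ⊗ fin` factorisation ★ `WeilCoinv.pairRep_finPairToAdelic_piSBReindex_tmul`); `χ_W`-COVARIANT for the weight `charCM χ̃`, `χ̃ = chiQuot a χ` —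
  `[Θ̃_{R_e E(Φ_∞ ⊗ ω_f(1,u)Φ_f)}(charCM χ̃) ∘ ιA] = χ_W(u) • [Θ̃_{R_e E(Φ_∞ ⊗ Φ_f)}(charCM χ̃) ∘ ιA]` (`toLp_lineThetaLift_tensor_finPairRep_one`: ★
  `toLp_lineThetaLift_pairRep_one_charCM` + ★ `coe_chiQuot_mk_finAdelicToAdelic`), i.e. `Φ_f ↦ [Θ̃_{R_e E(Φ_∞ ⊗ Φ_f)}(charCM χ̃) ∘ ιA]` kills the relation
  module of the `χ_W`-coinvariants ★ `omegaAtLine … a χ` — CONVENTION CHECK: it is `χ_W = lineChar a χ` itself, not its inverse.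

HONEST SCOPE.  Nothing of [Liu2021] is asserted; this file books nothing and discharges nothing booked (the discharge of ★
`meetsThetaLiftFromLine_hasFinComponent_rhoAtLine` is the Summit-side closer over the sequel).  HC_CM is proved only modulo the printed citations until
rung 0 closes.

## References
* [Liu2021] Y. Liu, *Fourier–Jacobi cycles and arithmetic relative trace formula*, Camb. J. Math. 9 (2021) = arXiv:2102.11518, proof of
  Prop. 4.13 Case 1 (l. 2131–2137, p. 48); Def. 4.11 (l. 2090–2096); App. D §D.1 Step 3 (l. 5221).
* [Weil1964] A. Weil, Acta Math. 111 (1964), Chap. III n° 37–38 p. 188–190 (the `arch ⊗ fin` factorisation of the Weil representation), n° 41 Thm 6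
  p. 193 (linearity of the theta distribution).
* [BorelJacquet1979] A. Borel, H. Jacquet, PSPM 33.1 (1979), §4.1 (`G(𝔸) = G_∞ × G(𝔸_f)`), §4.6 (right regular representation, `π ≅ π_∞ ⊗ π_f`).
* [GelbartRogawski1991] S. Gelbart, J. Rogawski, Invent. Math. 105 (1991), §3.2 p. 457 (theta lifts of characters of `U(1)`).
* [FleigEtAl2018] P. Fleig, H. Gustafsson, A. Kleinschmidt, D. Persson, CUP (2018), §12.3 Def. 12.5 (12.37) p. 296 (the theta lift).
-/


set_option autoImplicit false

noncomputable section

open NumberField MeasureTheory IsDedekindDomain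
open scoped Matrix Kronecker ComplexOrder ENNReal SchwartzMap TensorProduct Classical

namespace Literature.NumberTheory.Automorphic.Liu2021

open _root_.MeasureTheory
open Literature.NumberTheory.Automorphic Literature.NumberTheory.Automorphic.UnitaryGroup
open Literature.NumberTheory.Automorphic.UnitaryGroup.CotangentForms
open Literature.NumberTheory.Automorphic.IdeleClassGroup
open Literature.NumberTheory.Automorphic.Liu2021.Def411WeilCarriers
open Literature.NumberTheory.Automorphic.Liu2021.Def411WeilCarriersDoubling
open Literature.NumberTheory.GelbartRogawski1991 Literature.NumberTheory.GelbartRogawski1991.UnitaryDualPair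
open Literature.NumberTheory.GelbartRogawski1991.UnitaryDualPair.WeilCoinv
open Literature.NumberTheory.Weil1964
open Literature.RepresentationTheory Literature.RepresentationTheory.Liu2021
open Literature.RepresentationTheory.CompactGroups

/-! ## §0 The finite frame transport of the letter is the canonical one `k ↦ (g_𝔸⁻¹ (1, k) g_𝔸)_f` -/

section Frame

variable (L : Type) [Field L] [NumberField L] [IsCMField L] (N : ℕ) (H : Matrix (Fin N) (Fin N) L) (dV : Fin N → L) (g : GL (Fin N) L)
  (hg : ((g : Matrix (Fin N) (Fin N) L).map (cmConjRingHom L))ᵀ * H * (g : Matrix (Fin N) (Fin N) L) = Matrix.diagonal dV)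

/-- **Matrix formula of the canonical finite frame transport**: `↑((g_𝔸⁻¹ (1, k) g_𝔸)_f) = g_f⁻¹ · k · g_f` in `GL_N(𝔸_{L,f})`, `g_f = toFinAdeleGL L N g`
(the finite part of conjugation by the principal adele `g_𝔸 = (g_∞, g_f)` is conjugation by `g_f`). [cite: BorelJacquet1979, §4.1] -/
theorem coe_finPart_cmAdelicFrameTransport_finAdelicToAdelic (k : finAdelic (↥(maximalRealSubfield L)) L (IsCMField.complexConj L) N H) :
    ((finPart (↥(maximalRealSubfield L)) L (IsCMField.complexConj L) N (Matrix.diagonal dV)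
        (cmAdelicFrameTransport L N H dV g hg (finAdelicToAdelic (↥(maximalRealSubfield L)) L (IsCMField.complexConj L) N H k)) :
          finAdelic (↥(maximalRealSubfield L)) L (IsCMField.complexConj L) N (Matrix.diagonal dV)) :
        GL (Fin N) (FiniteAdeleRing (𝓞 L) L)) =
      (toFinAdeleGL L N g)⁻¹ * (k : GL (Fin N) (FiniteAdeleRing (𝓞 L) L)) * toFinAdeleGL L N g := by
  have hsnd : GLn.sndHom N L (toAdeleGL L g) = toFinAdeleGL L N g := Units.ext (Matrix.ext fun _ _ => rfl)
  rw [coe_finPart, adelicVal_apply, coe_cmAdelicFrameTransport, map_mul, map_mul, map_inv, hsnd, adelicVal_finAdelicToAdelic,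
    GLn.sndHom_ofFinite]

/-- **The letter's `ιV` IS the canonical finite transport**: a homomorphism `ιV : U(H)(𝔸_{L⁺,f}) →* U(diag dV)(𝔸_{L⁺,f})` with
`↑(ιV k) = g_f⁻¹ · k · g_f` for all `k` (the hypothesis `hιV` of (C♯)hol ∕ node B) equals `finPart ∘ cmAdelicFrameTransport ∘ finAdelicToAdelic`
(= `finPart ∘ cmKTypeHom ∘ finAdelicToAdelic` of ★ `UnitaryDualPairThetaKernelCMKTypeFin`, `rfl`). [cite: BorelJacquet1979, §4.1] -/
theorem eq_finPart_cmAdelicFrameTransport_finAdelicToAdelic_of_coe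
    (ιV : finAdelic (↥(maximalRealSubfield L)) L (IsCMField.complexConj L) N H →*
      finAdelic (↥(maximalRealSubfield L)) L (IsCMField.complexConj L) N (Matrix.diagonal dV))
    (hιV : ∀ k, ((ιV k : finAdelic (↥(maximalRealSubfield L)) L (IsCMField.complexConj L) N (Matrix.diagonal dV)) :
          GL (Fin N) (FiniteAdeleRing (𝓞 L) L)) =
        (toFinAdeleGL L N g)⁻¹ * (k : GL (Fin N) (FiniteAdeleRing (𝓞 L) L)) * toFinAdeleGL L N g) :
    ιV = (finPart (↥(maximalRealSubfield L)) L (IsCMField.complexConj L) N (Matrix.diagonal dV)).comp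
      ((cmAdelicFrameTransport L N H dV g hg).comp (finAdelicToAdelic (↥(maximalRealSubfield L)) L (IsCMField.complexConj L) N H)) :=
  MonoidHom.ext fun k => Subtype.ext
    ((hιV k).trans (coe_finPart_cmAdelicFrameTransport_finAdelicToAdelic L N H dV g hg k).symm)

/-- `ιA (1, k) = (1, ιV k)`: the adelic transport of a finite-adelic element is the finite-adelic element of its canonical finite transport
(★ `finAdelicToAdelic_finPart_cmKTypeHom_finAdelicToAdelic`, retyped on ★ `cmAdelicFrameTransport`). [cite: BorelJacquet1979, §4.1] -/
theorem cmAdelicFrameTransport_finAdelicToAdelic (k : finAdelic (↥(maximalRealSubfield L)) L (IsCMField.complexConj L) N H) :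
    cmAdelicFrameTransport L N H dV g hg (finAdelicToAdelic (↥(maximalRealSubfield L)) L (IsCMField.complexConj L) N H k) =
      finAdelicToAdelic (↥(maximalRealSubfield L)) L (IsCMField.complexConj L) N (Matrix.diagonal dV)
        (finPart (↥(maximalRealSubfield L)) L (IsCMField.complexConj L) N (Matrix.diagonal dV)
          (cmAdelicFrameTransport L N H dV g hg (finAdelicToAdelic (↥(maximalRealSubfield L)) L (IsCMField.complexConj L) N H k))) :=
  (finAdelicToAdelic_finPart_cmKTypeHom_finAdelicToAdelic L H g dV hg k).symm

/-- the canonical finite transport is onto (★ `finPart_cmKTypeHom_finAdelicToAdelic_surjective`). [cite: BorelJacquet1979, §4.1] -/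
theorem finPart_cmAdelicFrameTransport_finAdelicToAdelic_surjective :
    Function.Surjective ((finPart (↥(maximalRealSubfield L)) L (IsCMField.complexConj L) N (Matrix.diagonal dV)).comp
      ((cmAdelicFrameTransport L N H dV g hg).comp (finAdelicToAdelic (↥(maximalRealSubfield L)) L (IsCMField.complexConj L) N H))) :=
  finPart_cmKTypeHom_finAdelicToAdelic_surjective L H g dV hg

end Frame

section FinRep

variable {F E : Type} [Field F] [NumberField F] [Field E] [NumberField E] [Algebra F E] {c : E ≃ₐ[F] E} {N : ℕ}
  {J : Matrix (Fin N) (Fin N) E} {μ : Measure (adelicGroupData F E c N J).automorphicQuotient}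
  [(adelicGroupData F E c N J).IsAutomorphicMeasure μ]

/-- unfolding ★ `DiscreteAutomorphicRep.finRep`: `P_f(k) v = Π((1, k)) v`, `Π = P.space.toContRep`. [cite: BorelJacquet1979, §4.6] -/
theorem _root_.Literature.NumberTheory.Automorphic.DiscreteAutomorphicRep.finRep_apply
    (P : DiscreteAutomorphicRep (adelicGroupData F E c N J) μ) (k : finAdelic F E c N J) (v : P.space.toSubmodule) :
    P.finRep k v = P.space.toContRep (finAdelicToAdelic F E c N J k) v := rfl

end FinRep

/-! ## §1 The class `[Θ̃_{R_e E(Φ_∞ ⊗ Φ_f)}(f) ∘ ιA]` as a function of the finite Schwartz–Bruhat factor `Φ_f` -/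

section Tensor

variable (L : Type) [Field L] [NumberField L] [IsCMField L] (N : ℕ) (H : Matrix (Fin N) (Fin N) L)
  {n' : ℕ} (e₁ : Fin N × Fin 1 ≃ Fin n') (dV : Fin N → L) (hdV : ∀ i, IsCMField.complexConj L (dV i) = dV i)
  (hdV0 : ∀ i, dV i ≠ 0) (g : GL (Fin N) L)
  (hg : ((g : Matrix (Fin N) (Fin N) L).map (cmConjRingHom L))ᵀ * H * (g : Matrix (Fin N) (Fin N) L) = Matrix.diagonal dV)
  (μ : Literature.NumberTheory.Automorphic.IdeleClassGroup L →ₜ* Circle) (hμ : IsConjugateSymplectic L μ) (a : (↥(maximalRealSubfield L))ˣ)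
  (hρ : HasThetaMajorants fun
      (p : ↥(UnitaryGroup.adelic (↥(maximalRealSubfield L)) L (IsCMField.complexConj L) N (Matrix.diagonal dV)) × ↥(UnitaryGroup.adelic (↥(maximalRealSubfield L)) L (IsCMField.complexConj L) 1 (JW (↥(maximalRealSubfield L)) L a))) (Φ : piSchwartzBruhat (↥(maximalRealSubfield L)) (Fin n')) =>
        pairRep (↥(maximalRealSubfield L)) L (IsCMField.complexConj L) N 1 e₁ (Matrix.diagonal dV) (JW (↥(maximalRealSubfield L)) L a)
          (chiSplittingLine L e₁ dV hdV hdV0 (toHeckeCharacter L μ) (isUnitary_toHeckeCharacter L μ)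
            ((isOscillatorChar_toHeckeCharacter_iff μ).mpr hμ) (TW (↥(maximalRealSubfield L)) a)
            (isUnit_det_TW (↥(maximalRealSubfield L)) a) (JW (↥(maximalRealSubfield L)) L a) (JW_eq (↥(maximalRealSubfield L)) L a))
          p Φ)
  [CompactSpace (↥(UnitaryGroup.adelic (↥(maximalRealSubfield L)) L (IsCMField.complexConj L) N (Matrix.diagonal dV)) ⧸ (UnitaryGroup.toAdelic (↥(maximalRealSubfield L)) L (IsCMField.complexConj L) N (Matrix.diagonal dV)).range)] [MeasurableSpace (↥(UnitaryGroup.adelic (↥(maximalRealSubfield L)) L (IsCMField.complexConj L) 1 (JW (↥(maximalRealSubfield L)) L a)) ⧸ (UnitaryGroup.toAdelic (↥(maximalRealSubfield L)) L (IsCMField.complexConj L) 1 (JW (↥(maximalRealSubfield L)) L a)).range)] (μW : Measure (↥(UnitaryGroup.adelic (↥(maximalRealSubfield L)) L (IsCMField.complexConj L) 1 (JW (↥(maximalRealSubfield L)) L a)) ⧸ (UnitaryGroup.toAdelic (↥(maximalRealSubfield L)) L (IsCMField.complexConj L) 1 (JW (↥(maximalRealSubfield L)) L a)).range))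
  (f : C((↥(UnitaryGroup.adelic (↥(maximalRealSubfield L)) L (IsCMField.complexConj L) 1 (JW (↥(maximalRealSubfield L)) L a)) ⧸ (UnitaryGroup.toAdelic (↥(maximalRealSubfield L)) L (IsCMField.complexConj L) 1 (JW (↥(maximalRealSubfield L)) L a)).range), ℂ))
  (φ : 𝓢(((Fin N × Fin 1) → NumberField.mixedEmbedding.mixedSpace ↥(maximalRealSubfield L)), ℂ))
  [CompactSpace (adelicGroupData (↥(maximalRealSubfield L)) L (IsCMField.complexConj L) N H).automorphicQuotient]
  (ν : Measure (adelicGroupData (↥(maximalRealSubfield L)) L (IsCMField.complexConj L) N H).automorphicQuotient) [IsFiniteMeasure ν]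

/-- congruence of the class `[Θ̃_Ψ(f) ∘ ιA]` in the Schwartz–Bruhat datum (bookkeeping for the proof-carrying `MemLp.toLp`).
[cite: FleigEtAl2018, §12.3 Def. 12.5 (12.37) p. 296] -/
theorem toLp_lineThetaLift_congr {Ψ₁ Ψ₂ : piSchwartzBruhat (↥(maximalRealSubfield L)) (Fin n')} (h : Ψ₁ = Ψ₂) :
    MemLp.toLp _ (memLp_toQuotFun_lineThetaLift L N H e₁ dV hdV hdV0 g hg μ hμ a hρ μW Ψ₁ f ν 2) =
      MemLp.toLp _ (memLp_toQuotFun_lineThetaLift L N H e₁ dV hdV hdV0 g hg μ hμ a hρ μW Ψ₂ f ν 2) := by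
  subst h; rfl

/-- **Homogeneity in the finite factor**: `[Θ̃_{R_e E(Φ_∞ ⊗ c•Φ_f)}(f) ∘ ιA] = c • [Θ̃_{R_e E(Φ_∞ ⊗ Φ_f)}(f) ∘ ιA]`.
[cite: Weil1964, Chap. III n° 41 Thm 6 p. 193] -/
theorem toLp_lineThetaLift_tensor_smul (c : ℂ) (Φf : FinSB (↥(maximalRealSubfield L)) (Fin N × Fin 1)) :
    MemLp.toLp _ (memLp_toQuotFun_lineThetaLift L N H e₁ dV hdV hdV0 g hg μ hμ a hρ μW
        (piSBReindex (↥(maximalRealSubfield L)) e₁ (piSchwartzBruhatEquiv (↥(maximalRealSubfield L)) (Fin N × Fin 1) (φ ⊗ₜ[ℂ] (c • Φf)))) f ν 2) =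
      c • MemLp.toLp _ (memLp_toQuotFun_lineThetaLift L N H e₁ dV hdV hdV0 g hg μ hμ a hρ μW
          (piSBReindex (↥(maximalRealSubfield L)) e₁ (piSchwartzBruhatEquiv (↥(maximalRealSubfield L)) (Fin N × Fin 1) (φ ⊗ₜ[ℂ] Φf))) f ν 2) := by
  rw [toLp_lineThetaLift_congr L N H e₁ dV hdV hdV0 g hg μ hμ a hρ μW f ν
    (show piSBReindex (↥(maximalRealSubfield L)) e₁ (piSchwartzBruhatEquiv (↥(maximalRealSubfield L)) (Fin N × Fin 1) (φ ⊗ₜ[ℂ] (c • Φf))) =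
        c • piSBReindex (↥(maximalRealSubfield L)) e₁ (piSchwartzBruhatEquiv (↥(maximalRealSubfield L)) (Fin N × Fin 1) (φ ⊗ₜ[ℂ] Φf)) by
      rw [TensorProduct.tmul_smul, map_smul, map_smul])]
  exact toLp_lineThetaLift_smul_left L N H e₁ dV hdV hdV0 g hg μ hμ a hρ μW f ν c _

variable [BorelSpace (↥(UnitaryGroup.adelic (↥(maximalRealSubfield L)) L (IsCMField.complexConj L) 1 (JW (↥(maximalRealSubfield L)) L a)) ⧸ (UnitaryGroup.toAdelic (↥(maximalRealSubfield L)) L (IsCMField.complexConj L) 1 (JW (↥(maximalRealSubfield L)) L a)).range)] [IsFiniteMeasure μW]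

/-- **Additivity in the finite factor**: `[Θ̃_{R_e E(Φ_∞ ⊗ (Φ_f + Φ_f'))}(f) ∘ ιA] = [Θ̃_{R_e E(Φ_∞ ⊗ Φ_f)}(f) ∘ ιA] + [Θ̃_{R_e E(Φ_∞ ⊗ Φ_f')}(f) ∘ ιA]`
(bilinearity of `⊗` + ★ `toLp_lineThetaLift_add_left`). [cite: Weil1964, Chap. III n° 41 Thm 6 p. 193] -/
theorem toLp_lineThetaLift_tensor_add (Φf Φf' : FinSB (↥(maximalRealSubfield L)) (Fin N × Fin 1)) :
    MemLp.toLp _ (memLp_toQuotFun_lineThetaLift L N H e₁ dV hdV hdV0 g hg μ hμ a hρ μW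
        (piSBReindex (↥(maximalRealSubfield L)) e₁ (piSchwartzBruhatEquiv (↥(maximalRealSubfield L)) (Fin N × Fin 1) (φ ⊗ₜ[ℂ] (Φf + Φf')))) f ν 2) =
      MemLp.toLp _ (memLp_toQuotFun_lineThetaLift L N H e₁ dV hdV hdV0 g hg μ hμ a hρ μW
          (piSBReindex (↥(maximalRealSubfield L)) e₁ (piSchwartzBruhatEquiv (↥(maximalRealSubfield L)) (Fin N × Fin 1) (φ ⊗ₜ[ℂ] Φf))) f ν 2) +
        MemLp.toLp _ (memLp_toQuotFun_lineThetaLift L N H e₁ dV hdV hdV0 g hg μ hμ a hρ μW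
          (piSBReindex (↥(maximalRealSubfield L)) e₁ (piSchwartzBruhatEquiv (↥(maximalRealSubfield L)) (Fin N × Fin 1) (φ ⊗ₜ[ℂ] Φf'))) f ν 2) := by
  rw [toLp_lineThetaLift_congr L N H e₁ dV hdV hdV0 g hg μ hμ a hρ μW f ν
    (show piSBReindex (↥(maximalRealSubfield L)) e₁ (piSchwartzBruhatEquiv (↥(maximalRealSubfield L)) (Fin N × Fin 1) (φ ⊗ₜ[ℂ] (Φf + Φf'))) =
        piSBReindex (↥(maximalRealSubfield L)) e₁ (piSchwartzBruhatEquiv (↥(maximalRealSubfield L)) (Fin N × Fin 1) (φ ⊗ₜ[ℂ] Φf)) +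
          piSBReindex (↥(maximalRealSubfield L)) e₁ (piSchwartzBruhatEquiv (↥(maximalRealSubfield L)) (Fin N × Fin 1) (φ ⊗ₜ[ℂ] Φf')) by
      rw [TensorProduct.tmul_add, map_add, map_add])]
  exact toLp_lineThetaLift_add_left L N H e₁ dV hdV hdV0 g hg μ hμ a hρ μW f ν _ _

variable [SMulInvariantMeasure (adelicGroupData (↥(maximalRealSubfield L)) L (IsCMField.complexConj L) N H).Adelic (adelicGroupData (↥(maximalRealSubfield L)) L (IsCMField.complexConj L) N H).automorphicQuotient ν]

/-- **`U(H)(𝔸_{L⁺,f})`-EQUIVARIANCE in the finite factor**: `R((1,k)) [Θ̃_{R_e E(Φ_∞ ⊗ Φ_f)}(f) ∘ ιA] = [Θ̃_{R_e E(Φ_∞ ⊗ ω_f(ιV k, 1) Φ_f)}(f) ∘ ιA]`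
for the canonical finite transport `ιV k = (g_𝔸⁻¹ (1,k) g_𝔸)_f` (★ `rightRegular_toLp_lineThetaLift` at `(1, k)`; `ιA (1,k) = (1, ιV k)`; the `arch ⊗ fin`
factorisation ★ `pairRep_finPairToAdelic_piSBReindex_tmul` of the Weil representation at finite-adelic pair points).
[cite: BorelJacquet1979, §4.6] [cite: Weil1964, Chap. III n° 37–38 p. 188–190] -/
theorem rightRegular_finAdelicToAdelic_toLp_lineThetaLift_tensor (k : finAdelic (↥(maximalRealSubfield L)) L (IsCMField.complexConj L) N H)
    (Φf : FinSB (↥(maximalRealSubfield L)) (Fin N × Fin 1)) :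
    (adelicGroupData (↥(maximalRealSubfield L)) L (IsCMField.complexConj L) N H).rightRegular ν
        (finAdelicToAdelic (↥(maximalRealSubfield L)) L (IsCMField.complexConj L) N H k)
        (MemLp.toLp _ (memLp_toQuotFun_lineThetaLift L N H e₁ dV hdV hdV0 g hg μ hμ a hρ μW
          (piSBReindex (↥(maximalRealSubfield L)) e₁ (piSchwartzBruhatEquiv (↥(maximalRealSubfield L)) (Fin N × Fin 1) (φ ⊗ₜ[ℂ] Φf))) f ν 2)) =
      MemLp.toLp _ (memLp_toQuotFun_lineThetaLift L N H e₁ dV hdV hdV0 g hg μ hμ a hρ μW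
        (piSBReindex (↥(maximalRealSubfield L)) e₁ (piSchwartzBruhatEquiv (↥(maximalRealSubfield L)) (Fin N × Fin 1)
          (φ ⊗ₜ[ℂ] finPairRep (↥(maximalRealSubfield L)) L (IsCMField.complexConj L) N 1 e₁ (Matrix.diagonal dV) (JW (↥(maximalRealSubfield L)) L a)
            (complexConj_imagUnit L) (imagUnit_ne_zero L) (imagUnit_mul_self L) (realDiagonal_isSymm L dV hdV) (isSymm_TW (↥(maximalRealSubfield L)) a)
            (isUnit_det_realDiagonal L dV hdV hdV0) (isUnit_det_TW (↥(maximalRealSubfield L)) a) (realDiagonal_map L dV hdV).symm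
            (JW_eq (↥(maximalRealSubfield L)) L a)
            (isCompatible_chiSplittingLine L e₁ dV hdV hdV0 (toHeckeCharacter L μ) (isUnitary_toHeckeCharacter L μ)
              ((isOscillatorChar_toHeckeCharacter_iff μ).mpr hμ) (TW (↥(maximalRealSubfield L)) a) (isSymm_TW (↥(maximalRealSubfield L)) a)
              (isUnit_det_TW (↥(maximalRealSubfield L)) a) (JW (↥(maximalRealSubfield L)) L a) (JW_eq (↥(maximalRealSubfield L)) L a))
            ((finPart (↥(maximalRealSubfield L)) L (IsCMField.complexConj L) N (Matrix.diagonal dV)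
              (cmAdelicFrameTransport L N H dV g hg (finAdelicToAdelic (↥(maximalRealSubfield L)) L (IsCMField.complexConj L) N H k))), 1) Φf))) f ν 2) := by
  rw [rightRegular_toLp_lineThetaLift L N H e₁ dV hdV hdV0 g hg μ hμ a hρ μW _ f ν]
  refine toLp_lineThetaLift_congr L N H e₁ dV hdV hdV0 g hg μ hμ a hρ μW f ν ?_
  -- `(ιA (1,k), 1) = ((1, ιV k), (1, 1))` as an element of the adelic dual pair
  have hp : ((cmAdelicFrameTransport L N H dV g hg) (finAdelicToAdelic (↥(maximalRealSubfield L)) L (IsCMField.complexConj L) N H k),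
        (1 : ↥(UnitaryGroup.adelic (↥(maximalRealSubfield L)) L (IsCMField.complexConj L) 1 (JW (↥(maximalRealSubfield L)) L a)))) =
      finPairToAdelic (↥(maximalRealSubfield L)) L (IsCMField.complexConj L) N 1 (Matrix.diagonal dV) (JW (↥(maximalRealSubfield L)) L a)
        ((finPart (↥(maximalRealSubfield L)) L (IsCMField.complexConj L) N (Matrix.diagonal dV)
          (cmAdelicFrameTransport L N H dV g hg (finAdelicToAdelic (↥(maximalRealSubfield L)) L (IsCMField.complexConj L) N H k))), 1) :=
    Prod.ext (cmAdelicFrameTransport_finAdelicToAdelic L N H dV g hg k)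
      (by rw [finPairToAdelic_apply, map_one]; rfl)
  rw [hp]
  exact pairRep_finPairToAdelic_piSBReindex_tmul (↥(maximalRealSubfield L)) L (IsCMField.complexConj L) N 1 e₁ (Matrix.diagonal dV)
    (JW (↥(maximalRealSubfield L)) L a) (complexConj_imagUnit L) (imagUnit_ne_zero L) (imagUnit_mul_self L) (realDiagonal_isSymm L dV hdV)
    (isSymm_TW (↥(maximalRealSubfield L)) a) (isUnit_det_realDiagonal L dV hdV hdV0) (isUnit_det_TW (↥(maximalRealSubfield L)) a)
    (realDiagonal_map L dV hdV).symm (JW_eq (↥(maximalRealSubfield L)) L a) _ _ φ Φf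


variable [SMulInvariantMeasure ↥(UnitaryGroup.adelic (↥(maximalRealSubfield L)) L (IsCMField.complexConj L) 1 (JW (↥(maximalRealSubfield L)) L a)) (↥(UnitaryGroup.adelic (↥(maximalRealSubfield L)) L (IsCMField.complexConj L) 1 (JW (↥(maximalRealSubfield L)) L a)) ⧸ (UnitaryGroup.toAdelic (↥(maximalRealSubfield L)) L (IsCMField.complexConj L) 1 (JW (↥(maximalRealSubfield L)) L a)).range) μW]

omit [SMulInvariantMeasure (adelicGroupData (↥(maximalRealSubfield L)) L (IsCMField.complexConj L) N H).Adelic (adelicGroupData (↥(maximalRealSubfield L)) L (IsCMField.complexConj L) N H).automorphicQuotient ν] in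
/-- **`χ_W`-COVARIANCE in the finite factor**: `[Θ̃_{R_e E(Φ_∞ ⊗ ω_f(1,u)Φ_f)}(charCM χ̃) ∘ ιA] = χ_W(u) • [Θ̃_{R_e E(Φ_∞ ⊗ Φ_f)}(charCM χ̃) ∘ ιA]` for
`u ∈ U(⟨a⟩)(𝔸_{L⁺,f})`, `χ̃ = chiQuot a χ` (trivial at `∞`, finite part `χ_W = lineChar a χ`): ★ `toLp_lineThetaLift_pairRep_one_charCM` at `h = (1, u)`
and ★ `coe_chiQuot_mk_finAdelicToAdelic` — the map `Φ_f ↦ [Θ̃_{R_e E(Φ_∞ ⊗ Φ_f)}(charCM χ̃) ∘ ιA]` kills the relation module of the `χ_W`-coinvariants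
`omegaAtLine … a χ`. [cite: Liu2021, App. D §D.1 Step 3 (l. 5221)] [cite: GelbartRogawski1991, §3.2 p. 457] -/
theorem toLp_lineThetaLift_tensor_finPairRep_one (χ : Chi (↥(maximalRealSubfield L)) L (IsCMField.complexConj L))
    (u : finAdelic (↥(maximalRealSubfield L)) L (IsCMField.complexConj L) 1 (JW (↥(maximalRealSubfield L)) L a))
    (Φf : FinSB (↥(maximalRealSubfield L)) (Fin N × Fin 1)) :
    haveI := normal_range_toAdelic_JW L a
    MemLp.toLp _ (memLp_toQuotFun_lineThetaLift L N H e₁ dV hdV hdV0 g hg μ hμ a hρ μW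
        (piSBReindex (↥(maximalRealSubfield L)) e₁ (piSchwartzBruhatEquiv (↥(maximalRealSubfield L)) (Fin N × Fin 1)
          (φ ⊗ₜ[ℂ] finPairRep (↥(maximalRealSubfield L)) L (IsCMField.complexConj L) N 1 e₁ (Matrix.diagonal dV) (JW (↥(maximalRealSubfield L)) L a)
            (complexConj_imagUnit L) (imagUnit_ne_zero L) (imagUnit_mul_self L) (realDiagonal_isSymm L dV hdV) (isSymm_TW (↥(maximalRealSubfield L)) a)
            (isUnit_det_realDiagonal L dV hdV hdV0) (isUnit_det_TW (↥(maximalRealSubfield L)) a) (realDiagonal_map L dV hdV).symm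
            (JW_eq (↥(maximalRealSubfield L)) L a)
            (isCompatible_chiSplittingLine L e₁ dV hdV hdV0 (toHeckeCharacter L μ) (isUnitary_toHeckeCharacter L μ)
              ((isOscillatorChar_toHeckeCharacter_iff μ).mpr hμ) (TW (↥(maximalRealSubfield L)) a) (isSymm_TW (↥(maximalRealSubfield L)) a)
              (isUnit_det_TW (↥(maximalRealSubfield L)) a) (JW (↥(maximalRealSubfield L)) L a) (JW_eq (↥(maximalRealSubfield L)) L a))
            (1, u) Φf)))
        (charCM (chiQuot (↥(maximalRealSubfield L)) L (IsCMField.complexConj L) (Algebra.IsQuadraticExtension.finrank_eq_two _ L)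
          (IsCMField.complexConj_ne_one (K := L)) a χ)) ν 2) =
      ((lineChar (↥(maximalRealSubfield L)) L (IsCMField.complexConj L) a χ.1 u : ℂˣ) : ℂ) •
        MemLp.toLp _ (memLp_toQuotFun_lineThetaLift L N H e₁ dV hdV hdV0 g hg μ hμ a hρ μW
          (piSBReindex (↥(maximalRealSubfield L)) e₁ (piSchwartzBruhatEquiv (↥(maximalRealSubfield L)) (Fin N × Fin 1) (φ ⊗ₜ[ℂ] Φf)))
          (charCM (chiQuot (↥(maximalRealSubfield L)) L (IsCMField.complexConj L) (Algebra.IsQuadraticExtension.finrank_eq_two _ L)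
            (IsCMField.complexConj_ne_one (K := L)) a χ)) ν 2) := by
  haveI := normal_range_toAdelic_JW L a
  -- `((1,1), (1,u)) = finPairToAdelic (1, u)` in the adelic dual pair
  have hp : ((1, finAdelicToAdelic (↥(maximalRealSubfield L)) L (IsCMField.complexConj L) 1 (JW (↥(maximalRealSubfield L)) L a) u) :
        ↥(UnitaryGroup.adelic (↥(maximalRealSubfield L)) L (IsCMField.complexConj L) N (Matrix.diagonal dV)) ×
          ↥(UnitaryGroup.adelic (↥(maximalRealSubfield L)) L (IsCMField.complexConj L) 1 (JW (↥(maximalRealSubfield L)) L a))) =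
      finPairToAdelic (↥(maximalRealSubfield L)) L (IsCMField.complexConj L) N 1 (Matrix.diagonal dV) (JW (↥(maximalRealSubfield L)) L a) (1, u) := by
    simp only [finPairToAdelic_apply, map_one]
    rfl
  rw [toLp_lineThetaLift_congr L N H e₁ dV hdV hdV0 g hg μ hμ a hρ μW _ ν
    (show piSBReindex (↥(maximalRealSubfield L)) e₁ (piSchwartzBruhatEquiv (↥(maximalRealSubfield L)) (Fin N × Fin 1)
          (φ ⊗ₜ[ℂ] finPairRep (↥(maximalRealSubfield L)) L (IsCMField.complexConj L) N 1 e₁ (Matrix.diagonal dV) (JW (↥(maximalRealSubfield L)) L a)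
            (complexConj_imagUnit L) (imagUnit_ne_zero L) (imagUnit_mul_self L) (realDiagonal_isSymm L dV hdV) (isSymm_TW (↥(maximalRealSubfield L)) a)
            (isUnit_det_realDiagonal L dV hdV hdV0) (isUnit_det_TW (↥(maximalRealSubfield L)) a) (realDiagonal_map L dV hdV).symm
            (JW_eq (↥(maximalRealSubfield L)) L a)
            (isCompatible_chiSplittingLine L e₁ dV hdV hdV0 (toHeckeCharacter L μ) (isUnitary_toHeckeCharacter L μ)
              ((isOscillatorChar_toHeckeCharacter_iff μ).mpr hμ) (TW (↥(maximalRealSubfield L)) a) (isSymm_TW (↥(maximalRealSubfield L)) a)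
              (isUnit_det_TW (↥(maximalRealSubfield L)) a) (JW (↥(maximalRealSubfield L)) L a) (JW_eq (↥(maximalRealSubfield L)) L a))
            (1, u) Φf)) =
        pairRep (↥(maximalRealSubfield L)) L (IsCMField.complexConj L) N 1 e₁ (Matrix.diagonal dV) (JW (↥(maximalRealSubfield L)) L a)
          (chiSplittingLine L e₁ dV hdV hdV0 (toHeckeCharacter L μ) (isUnitary_toHeckeCharacter L μ)
            ((isOscillatorChar_toHeckeCharacter_iff μ).mpr hμ) (TW (↥(maximalRealSubfield L)) a)
            (isUnit_det_TW (↥(maximalRealSubfield L)) a) (JW (↥(maximalRealSubfield L)) L a) (JW_eq (↥(maximalRealSubfield L)) L a))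
          ((1, finAdelicToAdelic (↥(maximalRealSubfield L)) L (IsCMField.complexConj L) 1 (JW (↥(maximalRealSubfield L)) L a) u) :
            ↥(UnitaryGroup.adelic (↥(maximalRealSubfield L)) L (IsCMField.complexConj L) N (Matrix.diagonal dV)) ×
              ↥(UnitaryGroup.adelic (↥(maximalRealSubfield L)) L (IsCMField.complexConj L) 1 (JW (↥(maximalRealSubfield L)) L a)))
          (piSBReindex (↥(maximalRealSubfield L)) e₁ (piSchwartzBruhatEquiv (↥(maximalRealSubfield L)) (Fin N × Fin 1) (φ ⊗ₜ[ℂ] Φf))) by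
      rw [hp]
      exact (pairRep_finPairToAdelic_piSBReindex_tmul (↥(maximalRealSubfield L)) L (IsCMField.complexConj L) N 1 e₁ (Matrix.diagonal dV)
        (JW (↥(maximalRealSubfield L)) L a) (complexConj_imagUnit L) (imagUnit_ne_zero L) (imagUnit_mul_self L) (realDiagonal_isSymm L dV hdV)
        (isSymm_TW (↥(maximalRealSubfield L)) a) (isUnit_det_realDiagonal L dV hdV hdV0) (isUnit_det_TW (↥(maximalRealSubfield L)) a)
        (realDiagonal_map L dV hdV).symm (JW_eq (↥(maximalRealSubfield L)) L a) _ _ φ Φf).symm)]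
  rw [toLp_lineThetaLift_pairRep_one_charCM L N H e₁ dV hdV hdV0 g hg μ hμ a hρ μW _ ν
    (finAdelicToAdelic (↥(maximalRealSubfield L)) L (IsCMField.complexConj L) 1 (JW (↥(maximalRealSubfield L)) L a) u)
    (chiQuot (↥(maximalRealSubfield L)) L (IsCMField.complexConj L) (Algebra.IsQuadraticExtension.finrank_eq_two _ L)
      (IsCMField.complexConj_ne_one (K := L)) a χ),
    coe_chiQuot_mk_finAdelicToAdelic]

end Tensor

end Literature.NumberTheory.Automorphic.Liu2021

end
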